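import Summits.BirchSwinnertonDyer.BirchSwinnertonDyer.Theses.ShaPrimaryTransfer
import Summits.BirchSwinnertonDyer.BirchSwinnertonDyer.Theses.KolyvaginDepthDoor
import Summits.BirchSwinnertonDyer.BirchSwinnertonDyer.Theses.ShadowIsolation
import Summits.BirchSwinnertonDyer.BirchSwinnertonDyer.Theorems.ShaPrimaryTransferFiniteShaComponentTransferVersusX1
import Literature.NumberTheory.EllipticCurves.IwasawaLeadingTermProofs
import Literature.NumberTheory.EllipticCurves.BSDpVariableChangeProofs
import Literature.NumberTheory.EllipticCurves.BSDSelmerParityDokchitserProofs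

/-!
# BirchSwinnertonDyer / ShaPrimaryTransfer — crux `OneFiniteShaComponent` (stmt-BirchSwinnertonDyer-22357):
# the door against the registered items, in Selmer coordinates, and its exact residue

Route `ShaPrimaryTransfer` (D-0145 LINE 2): O = `OneFiniteShaComponent` (stmt-22357: every elliptic `E/ℚ` has SOME
prime `p₀` with `t_{p₀}(E) = corank_{ℤ_{p₀}} Ш(E)[p₀^∞] = 0`). The companion file `…OneFiniteShaComponentKernelDoors`
(route-independent) certifies the door at 2 in the kernel at ranks 0, 1, 2. This helper file (prover seat
`bsd-line-spt-p1`, `--supports stmt-22357 --as helper`)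
places O among the REGISTERED items and isolates its residue:

* §1 BY NAME (O is certified at every rank ≤ 2 in the companion file, `exists_oneFiniteShaComponent_instance_of_le_two`):
  on CM curves O ⟸ `KolyvaginDepthDoor.ShaCorankZeroAtOnePrimeOfCM` (stmt-21766; `HasCM` is a `j`-invariant property,
  so it passes to a minimal model); on the reducible sector (a good ordinary `p ≥ 5` with `E[p]` reducible)
  O ⟸ `ShadowIsolation.ShaCotorsionReducible` (stmt-15277). (O ⟸ KatoTransfer X1 and O ⟸ stmt-0132 are in the
  companion files `…VersusX1`, `…Slices`.)
* §2 SELMER COORDINATES (`Ш`-free): O ⟺ «every `E/ℚ` has a prime with `corank Sel_{p^∞} = rank`» ⟺ «… `≤ rank`».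
* §3 THE PROVED SLICE AND THE EXACT RESIDUE: granting Gross–Zagier–Kolyvagin (named fact
  `rank_eq_analyticRank_of_analyticRank_le_one`) analytic rank ≤ 1 is doored at EVERY prime, and O is EQUIVALENT to
  its restriction to analytic rank ≥ 2 (also in Selmer coordinates) — where the kernel certifies doors curve by curve
  (companion file) but no class-wide handle is in print (`Ш(E)[p]` unbounded for `p ≤ 13`, barrier
  `TwoDescentDefectUnbounded`; a curve with `Ш_div` of positive corank at every prime is excluded by no theorem).

Nothing here proves O, T or BSD; O is conjecture-grade at analytic rank ≥ 2 (the weakest form of the finiteness of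
`Ш`). References: R. Greenberg, LNM 1716 (1999), §1; V. Kolyvagin, *Euler systems* (1990), Thm. A; H. Darmon, CBMS
101 (2004), Thm. 3.22; J. H. Silverman, *AEC* 2nd ed., VIII.8.3, III.1.4(b), X.§4 Rem. 4.1.1.
-/

-- D-0017: single-problem summit, so `Summit.BirchSwinnertonDyer.BirchSwinnertonDyer.…` repeats a namespace BY DESIGN.
set_option linter.dupNamespace false

noncomputable section

namespace Summit.BirchSwinnertonDyer.BirchSwinnertonDyer.Theorems.ShaPrimaryTransferDoorsO

open scoped Classical
open Literature.NumberTheory.EllipticCurves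
open WeierstrassCurve
open Summit.BirchSwinnertonDyer.BirchSwinnertonDyer.Theses.ShaPrimaryTransfer (OneFiniteShaComponent)
open Summit.BirchSwinnertonDyer.BirchSwinnertonDyer.Theses.KolyvaginDepthDoor (ShaCorankZeroAtOnePrimeOfCM)
open Summit.BirchSwinnertonDyer.BirchSwinnertonDyer.Theses.ShadowIsolation (ShaCotorsionReducible)

/-! ## §1 O against the registered items, by name -/

/-- **On CM curves, O ⟸ `KolyvaginDepthDoor.ShaCorankZeroAtOnePrimeOfCM` (stmt-BirchSwinnertonDyer-21766).** Pass to
a global minimal model `C • W` (tree `hasGlobalMinimalModel_rat_holds`); `HasCM` depends only on `j` (tree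
`hasCM_iff_of_j_eq`, Mathlib `variableChange_j`); take 21766's prime there and carry `t_p = 0` back along `C`
(`…VersusX1.shaCorank_eq_zero_of_shaCorank_smul_eq_zero`). CONDITIONAL on the item `h21766` only. [cite: SilvermanAEC2009, VIII.8.3 and III.1.4(b)] -/
theorem oneFiniteShaComponent_of_hasCM_of_shaCorankZeroAtOnePrimeOfCM (h21766 : ShaCorankZeroAtOnePrimeOfCM)
    (W : WeierstrassCurve ℚ) [W.IsElliptic] (hCM : W.HasCM) :
    ∃ (p : ℕ) (_ : Fact p.Prime), W.shaCorank p = 0 := by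
  obtain ⟨C, hC⟩ := hasGlobalMinimalModel_rat_holds W
  haveI := hC
  have hCM' : (C • W).HasCM := (hasCM_iff_of_j_eq (W.variableChange_j C)).2 hCM
  obtain ⟨p, hp, -, -, -, h0⟩ := h21766 (C • W) hCM'
  exact ⟨p, hp, ShaPrimaryTransferVersusX1.shaCorank_eq_zero_of_shaCorank_smul_eq_zero W C p h0⟩

/-- **On the reducible sector, O ⟸ `ShadowIsolation.ShaCotorsionReducible` (stmt-BirchSwinnertonDyer-15277)**: a
global minimal `E/ℚ` with a good ordinary prime `p ≥ 5` at which `E[p]` is REDUCIBLE (a rational `p`-isogeny) is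
doored at that `p`, granting 15277. CONDITIONAL on the item `h15277` only. [folklore] -/
theorem door_of_shaCotorsionReducible (h15277 : ShaCotorsionReducible) (W : WeierstrassCurve ℚ) [W.IsElliptic]
    [W.IsGloballyMinimal] (p : ℕ) [hp : Fact p.Prime] (h5 : 5 ≤ p) (hgood : W.HasGoodReductionAtPrime p)
    (hord : ¬ (p : ℤ) ∣ W.frobeniusTrace p) (hred : ¬ W.HasIrreducibleModPGaloisRep p) :
    ∃ (q : ℕ) (_ : Fact q.Prime), W.shaCorank q = 0 :=
  ⟨p, hp, h15277 W p h5 hgood hord hred⟩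

/-! ## §2 O in Selmer coordinates -/

/-- **O ⟺ «every elliptic `E/ℚ` has a prime `p` with `corank_{ℤ_p} Sel_{p^∞}(E/ℚ) = rank E(ℚ)`»** (Greenberg's
identity `corank Sel_{p^∞} = rank + t_p`, tree `selmerCorank_eq_mordellWeilRank_add_holds`).
[cite: Greenberg1999LNM, §1 pp. 54–57] -/
theorem oneFiniteShaComponent_iff_selmerCorank_eq :
    OneFiniteShaComponent ↔ ∀ (W : WeierstrassCurve ℚ) [W.IsElliptic],
      ∃ (p : ℕ) (_ : Fact p.Prime), W.selmerCorank p = W.mordellWeilRank := by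
  constructor
  · intro h W _
    obtain ⟨p, hp, h0⟩ := h W
    have hid := W.selmerCorank_eq_mordellWeilRank_add_holds p
    exact ⟨p, hp, by omega⟩
  · intro h W _
    obtain ⟨p, hp, h0⟩ := h W
    have hid := W.selmerCorank_eq_mordellWeilRank_add_holds p
    exact ⟨p, hp, by omega⟩

/-- **O ⟺ «every elliptic `E/ℚ` has a prime `p` with `corank Sel_{p^∞}(E/ℚ) ≤ rank E(ℚ)`»** (`≥` is Kummer theory,
free). [cite: Greenberg1999LNM, §1 pp. 54–57] -/
theorem oneFiniteShaComponent_iff_selmerCorank_le :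
    OneFiniteShaComponent ↔ ∀ (W : WeierstrassCurve ℚ) [W.IsElliptic],
      ∃ (p : ℕ) (_ : Fact p.Prime), W.selmerCorank p ≤ W.mordellWeilRank := by
  rw [oneFiniteShaComponent_iff_selmerCorank_eq]
  refine ⟨fun h W _ => ?_, fun h W _ => ?_⟩
  · obtain ⟨p, hp, h0⟩ := h W
    exact ⟨p, hp, h0.le⟩
  · obtain ⟨p, hp, h0⟩ := h W
    have hid := W.selmerCorank_eq_mordellWeilRank_add_holds p
    exact ⟨p, hp, by omega⟩

/-! ## §3 The proved slice (analytic rank ≤ 1) and the exact residue of O -/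

/-- **Below analytic rank 2 every prime is a door prime**, granting Gross–Zagier–Kolyvagin (named fact
`rank_eq_analyticRank_of_analyticRank_le_one`: `ord_{s=1} L(E,s) ≤ 1 ⟹ rank = ord ∧ Ш(E/ℚ)` finite).
CONDITIONAL on `hGZK`. [cite: Kolyvagin1990, Thm. A] [cite: Darmon2004, Thm. 3.22] -/
theorem door_of_analyticRank_le_one (hGZK : rank_eq_analyticRank_of_analyticRank_le_one)
    (W : WeierstrassCurve ℚ) [W.IsElliptic] (hr : W.analyticRank ≤ 1) (p : ℕ) [Fact p.Prime] :
    W.shaCorank p = 0 :=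
  haveI := (hGZK W hr).2
  W.shaCorank_eq_zero_of_finite p

/-- O for curves of analytic rank ≤ 1, granting GZK. CONDITIONAL on `hGZK`. [cite: Kolyvagin1990, Thm. A] -/
theorem oneFiniteShaComponent_of_analyticRank_le_one (hGZK : rank_eq_analyticRank_of_analyticRank_le_one)
    (W : WeierstrassCurve ℚ) [W.IsElliptic] (hr : W.analyticRank ≤ 1) :
    ∃ (p : ℕ) (_ : Fact p.Prime), W.shaCorank p = 0 :=
  ⟨2, ⟨Nat.prime_two⟩, door_of_analyticRank_le_one hGZK W hr 2⟩

/-- **The exact open residue of O.** Granting Gross–Zagier–Kolyvagin, O is EQUIVALENT to its restriction to analytic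
rank ≥ 2 — where the kernel certifies doors curve by curve (companion file) but no class-wide handle is in print. CONDITIONAL on `hGZK` (only
the direction residue ⟹ O uses it). [cite: Kolyvagin1990, Thm. A] -/
theorem oneFiniteShaComponent_iff_kernel_of_GZK (hGZK : rank_eq_analyticRank_of_analyticRank_le_one) :
    OneFiniteShaComponent ↔ ∀ (W : WeierstrassCurve ℚ) [W.IsElliptic], 2 ≤ W.analyticRank →
      ∃ (p : ℕ) (_ : Fact p.Prime), W.shaCorank p = 0 := by
  refine ⟨fun h W _ _ => h W, fun h W _ => ?_⟩
  rcases Nat.lt_or_ge W.analyticRank 2 with hlt | hge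
  · exact oneFiniteShaComponent_of_analyticRank_le_one hGZK W (by omega)
  · exact h W hge

/-- **The residue in Selmer coordinates.** Granting GZK, O ⟺ «every elliptic `E/ℚ` of analytic rank ≥ 2 has a prime
`p` with `corank Sel_{p^∞}(E/ℚ) ≤ rank E(ℚ)`» — Selmer coranks and known points only. CONDITIONAL on `hGZK`.
[cite: Kolyvagin1990, Thm. A] [cite: Greenberg1999LNM, §1 pp. 54–57] -/
theorem oneFiniteShaComponent_iff_kernel_selmer_of_GZK (hGZK : rank_eq_analyticRank_of_analyticRank_le_one) :
    OneFiniteShaComponent ↔ ∀ (W : WeierstrassCurve ℚ) [W.IsElliptic], 2 ≤ W.analyticRank →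
      ∃ (p : ℕ) (_ : Fact p.Prime), W.selmerCorank p ≤ W.mordellWeilRank := by
  rw [oneFiniteShaComponent_iff_kernel_of_GZK hGZK]
  refine ⟨fun h W _ h2 => ?_, fun h W _ h2 => ?_⟩
  · obtain ⟨p, hp, h0⟩ := h W h2
    have hid := W.selmerCorank_eq_mordellWeilRank_add_holds p
    exact ⟨p, hp, by omega⟩
  · obtain ⟨p, hp, h0⟩ := h W h2
    have hid := W.selmerCorank_eq_mordellWeilRank_add_holds p
    exact ⟨p, hp, by omega⟩

end Summit.BirchSwinnertonDyer.BirchSwinnertonDyer.Theorems.ShaPrimaryTransferDoorsO
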